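import Mathlib
import Literature.Barriers.PneNP.ExtendedFormulationMinkowskiFaces
import Literature.Barriers.PneNP.ExtendedFormulationLinearImage
import Literature.Barriers.PneNP.CorrelationPolytopeXCLowerBoundGraph
import Summits.ValiantsHypothesis.ValiantsHypothesis.Theorems.FifoMatchingXcDivisionZmixFace
import Summits.ValiantsHypothesis.ValiantsHypothesis.Theorems.FifoMatchingXcDivisionChamberCertificate
import HarnessLib

/-!
# The SWITCHED-FACE RUNGS, part 1: the tower objects, the switching functional `C^{(a)}`, the `C`-face of a tower is ONE vertex, the deletion read (§1–§3)

Theorems-side TRANSPLANT (port hand val-port-1 g3; crit-9 g1 CONFIRM 21:07:55Z «P-P2a′», director R298 (2), desk RULING #347 (A);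
`--supports stmt-ValiantsHypothesis-21181 --as helper`) of val-idea-38 g1's crux workfile `Cruxes/NNDivisionHard/SwitchFaceTowerRung.lean`
REV 4 FINAL @27833a3f9586 (sha16 9555358f6f12b67d, 909 l.; farm rc 0 / 0 sorry / 0 warnings; crit-9 g1 re-probes of rev 3 VERIFIED, axioms std)
— texts VERBATIM, namespace moved `…Cruxes.NNDivisionHard.SwitchFace` ↦ `…Theorems.FifoMatching.SwitchFace`, the 909-line file split by the
400-line cap into four modules `…SwitchedFaceTower(Face | · | Zonotope | Tolerant).lean` (§1–§3 / §4–§6 / §7 / §8–§9).  This module: `tower`, `TowerSwitchRung`, §1 `exists_switchFun`/`switch_dot_corVec…`/`switch_valid`/`cor_face_eq`, §2 `vtx`/`sgn`/`hZ`/`tower_face`, §3 `delRead`/`delRead_face`.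
Credit: statements + proofs val-idea-38 g1 (W5-P2, card `Cruxes/NNDivisionHard/Ideas/switched-face-psd-free.md`); critic of record val-idea-crit-9 g1.
HONEST FRAMING: kernel food for an OPEN crux — located-point / switched-face certificates decide CLASSES of passengers (every 0-1 rank-one tower,
`COR − COR`, ±PSD zonotopes, self-similar read fibres) at the Kaibel–Weltge rate; stmt-21181 `NNDivisionHard` OPEN; COR-VIRTUAL OPEN;
`VP ≠ VNP` NOT proved; nothing here is a summit statement.
-/

set_option autoImplicit false

-- the mandated summit-side namespace repeats a component by design (single-problem summit)
set_option linter.dupNamespace false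

noncomputable section

open Matrix Finset
open scoped Pointwise

namespace Summit.ValiantsHypothesis.ValiantsHypothesis.Theorems.FifoMatching.SwitchFace

open Literature.Barriers.PneNP (HasEFOfSize)
open Literature.Combinatorics.Optimization (corPolytopeGraph corVec)
open Summit.ValiantsHypothesis.ValiantsHypothesis.Theorems.FifoMatching.XcDivision
  (dot_le_of_mem_convexHull convexHull_range_inter_eq corVec_top_apply corPolytopeGraph_top_add_hull_three_pow_le)

variable {n : ℕ}


/-- a 0/1 rank-one TOWER `Σ_{b : P b} [−1,1] · λ_b · b bᵀ` (same text as `PairFace.tower` / `SwitchFace.tower`). -/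
def tower (h : ℕ) (P : (Fin h → Bool) → Prop) [DecidablePred P] (lam : (Fin h → Bool) → ℝ) :
    Set (Fin h × Fin h → ℝ) :=
  convexHull ℝ (Set.range fun ε : (Fin h → Bool) → Bool =>
    ∑ b : Fin h → Bool, if P b then ((if ε b then (1 : ℝ) else -1) * lam b) • corVec ⊤ b else 0)

/-- ★★ the TOWER RUNG (statement identical to `SwitchFace.TowerSwitchRung` of the sketch). -/
def TowerSwitchRung : Prop :=
  ∀ (n : ℕ) (P : (Fin (n + 1) → Bool) → Prop) [DecidablePred P] (lam : (Fin (n + 1) → Bool) → ℝ) (r : ℕ),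
    HasEFOfSize (corPolytopeGraph (⊤ : SimpleGraph (Fin (n + 1))) + tower (n + 1) P lam) r →
      HasEFOfSize (corPolytopeGraph (⊤ : SimpleGraph (Fin n))) r

/-! ## §1 The switching functional `C^{(a)}`, through its dot products -/

/-- the switching functional `C^{(a)}` exists, through its dot products (`C·x = x_aa + Σ_{p≠a}(x_ap + x_pa − 2x_pp)`). -/
theorem exists_switchFun (a : Fin n) :
    ∃ C : Fin n × Fin n → ℝ, ∀ x : Fin n × Fin n → ℝ,
      C ⬝ᵥ x = x (a, a) + ∑ p : Fin n, if p ≠ a then x (a, p) + x (p, a) - 2 * x (p, p) else 0 := by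
  classical
  refine ⟨Pi.single (a, a) 1 + ∑ p : Fin n,
    if p ≠ a then (Pi.single (a, p) 1 + Pi.single (p, a) 1 - (2 : ℝ) • Pi.single (p, p) 1 :
      Fin n × Fin n → ℝ) else 0, fun x => ?_⟩
  rw [add_dotProduct, sum_dotProduct, single_dotProduct, one_mul]
  congr 1
  refine Finset.sum_congr rfl fun p _ => ?_
  split_ifs
  · rw [sub_dotProduct, add_dotProduct, smul_dotProduct, single_dotProduct, single_dotProduct, single_dotProduct,
      smul_eq_mul]
    ring
  · exact zero_dotProduct x

/-- the all-false vertex is the origin. -/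
theorem corVec_eq_zero_of_forall {b : Fin n → Bool} (hb : ∀ p, b p = false) :
    corVec (⊤ : SimpleGraph (Fin n)) b = 0 := by
  funext pq
  obtain ⟨p, q⟩ := pq
  rw [corVec_top_apply]
  simp [hb p]

section SwitchFun

variable (a : Fin n) {C : Fin n × Fin n → ℝ}
  (hC : ∀ x : Fin n × Fin n → ℝ,
    C ⬝ᵥ x = x (a, a) + ∑ p : Fin n, if p ≠ a then x (a, p) + x (p, a) - 2 * x (p, p) else 0)
include hC

/-- S1 — value on the vertices: `1` if `b_a = 1`, `−2·|b|` otherwise. -/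
theorem switch_dot_corVec (b : Fin n → Bool) :
    C ⬝ᵥ corVec (⊤ : SimpleGraph (Fin n)) b =
      if b a = true then 1 else ∑ p : Fin n, if p ≠ a then (if b p = true then (-2 : ℝ) else 0) else 0 := by
  rw [hC]
  cases hba : b a with
  | false =>
    rw [if_neg Bool.false_ne_true]
    have h1 : corVec (⊤ : SimpleGraph (Fin n)) b (a, a) = 0 := by
      rw [corVec_top_apply]; simp [hba]
    rw [h1, zero_add]
    refine Finset.sum_congr rfl fun p _ => ?_
    split_ifs with hp hbp
    · rw [corVec_top_apply, corVec_top_apply, corVec_top_apply]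
      simp [hba, hbp]
    · rw [corVec_top_apply, corVec_top_apply, corVec_top_apply]
      simp [hba, hbp]
    · rfl
  | true =>
    rw [if_pos rfl]
    have h1 : corVec (⊤ : SimpleGraph (Fin n)) b (a, a) = 1 := by
      rw [corVec_top_apply]; simp [hba]
    have h2 : ∑ p : Fin n, (if p ≠ a then corVec (⊤ : SimpleGraph (Fin n)) b (a, p) +
        corVec (⊤ : SimpleGraph (Fin n)) b (p, a) - 2 * corVec (⊤ : SimpleGraph (Fin n)) b (p, p) else 0) = 0 := by
      refine Finset.sum_eq_zero fun p _ => ?_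
      split_ifs with hp
      · rw [corVec_top_apply, corVec_top_apply, corVec_top_apply]
        cases b p <;> norm_num [hba]
      · rfl
    rw [h1, h2, add_zero]

/-- S2a — validity. -/
theorem switch_dot_corVec_le (b : Fin n → Bool) : C ⬝ᵥ corVec (⊤ : SimpleGraph (Fin n)) b ≤ 1 := by
  rw [switch_dot_corVec a hC]
  split_ifs
  · exact le_rfl
  · calc ∑ p : Fin n, (if p ≠ a then (if b p = true then (-2 : ℝ) else 0) else 0) ≤ 0 :=
          Finset.sum_nonpos fun p _ => by split_ifs <;> norm_num
      _ ≤ 1 := zero_le_one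

/-- S2b — tight exactly on the switched coordinate face `{b_a = 1}`. -/
theorem switch_dot_corVec_eq_one_iff (b : Fin n → Bool) :
    C ⬝ᵥ corVec (⊤ : SimpleGraph (Fin n)) b = 1 ↔ b a = true := by
  rw [switch_dot_corVec a hC]
  constructor
  · intro h
    by_contra hba
    rw [if_neg hba] at h
    have : ∑ p : Fin n, (if p ≠ a then (if b p = true then (-2 : ℝ) else 0) else 0) ≤ 0 :=
      Finset.sum_nonpos fun p _ => by split_ifs <;> norm_num
    linarith
  · intro hba
    rw [if_pos hba]

/-- S2c — NONZERO on every nonzero generator `bbᵀ`. -/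
theorem switch_dot_corVec_ne_zero (b : Fin n → Bool) (hb : ∃ p, b p = true) :
    C ⬝ᵥ corVec (⊤ : SimpleGraph (Fin n)) b ≠ 0 := by
  rw [switch_dot_corVec a hC]
  split_ifs with hba
  · exact one_ne_zero
  · obtain ⟨p₀, hp₀⟩ := hb
    have hp₀a : p₀ ≠ a := by
      rintro rfl
      exact hba hp₀
    have hle : ∑ p : Fin n, (if p ≠ a then (if b p = true then (-2 : ℝ) else 0) else 0) ≤
        (if p₀ ≠ a then (if b p₀ = true then (-2 : ℝ) else 0) else 0) := by
      have key := Finset.single_le_sum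
        (f := fun p : Fin n => -(if p ≠ a then (if b p = true then (-2 : ℝ) else 0) else 0))
        (fun p _ => by split_ifs <;> norm_num) (Finset.mem_univ p₀)
      simp only [Finset.sum_neg_distrib] at key
      linarith
    rw [if_pos hp₀a, if_pos hp₀] at hle
    have hlt : ∑ p : Fin n, (if p ≠ a then (if b p = true then (-2 : ℝ) else 0) else 0) < 0 := by linarith
    exact hlt.ne

/-- validity on the polytope. -/
theorem switch_valid : ∀ x ∈ corPolytopeGraph (⊤ : SimpleGraph (Fin n)), C ⬝ᵥ x ≤ 1 :=
  dot_le_of_mem_convexHull _ _ _ (by rintro _ ⟨b, rfl⟩; exact switch_dot_corVec_le a hC b)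

/-- S3a — the `C`-face of `COR(K_n)` is the hull of the vertices with `b_a = 1`. -/
theorem cor_face_eq :
    corPolytopeGraph (⊤ : SimpleGraph (Fin n)) ∩ {x | C ⬝ᵥ x = 1} =
      convexHull ℝ (Set.range fun b : {b : Fin n → Bool // C ⬝ᵥ corVec (⊤ : SimpleGraph (Fin n)) b = 1} =>
        corVec (⊤ : SimpleGraph (Fin n)) b.1) := by
  unfold corPolytopeGraph
  exact convexHull_range_inter_eq _ C 1 (switch_dot_corVec_le a hC)

/-! ## §2 The `C`-face of a tower is ONE vertex -/

section Tower

variable (P : (Fin n → Bool) → Prop) [DecidablePred P] (lam : (Fin n → Bool) → ℝ)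

/-- the sign vertices of the tower. -/
def vtx (ε : (Fin n → Bool) → Bool) : Fin n × Fin n → ℝ :=
  ∑ b : Fin n → Bool, if P b then ((if ε b then (1 : ℝ) else -1) * lam b) • corVec ⊤ b else 0

/-- the maximising sign pattern for `C`. -/
def sgn : (Fin n → Bool) → Bool := fun b => decide (0 ≤ lam b * (C ⬝ᵥ corVec (⊤ : SimpleGraph (Fin n)) b))

/-- the support value `h_Z(C) = Σ_{P b} |λ_b · C·bbᵀ|`. -/
def hZ : ℝ := ∑ b : Fin n → Bool, if P b then |lam b * (C ⬝ᵥ corVec (⊤ : SimpleGraph (Fin n)) b)| else 0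

omit hC in
/-- the value of `C` at a tower vertex `vtx ε`. -/
theorem dot_vtx (ε : (Fin n → Bool) → Bool) :
    C ⬝ᵥ vtx P lam ε =
      ∑ b : Fin n → Bool, if P b then (if ε b then (1 : ℝ) else -1) * (lam b * (C ⬝ᵥ corVec ⊤ b)) else 0 := by
  unfold vtx
  rw [dotProduct_sum]
  refine Finset.sum_congr rfl fun b _ => ?_
  by_cases hP : P b
  · rw [if_pos hP, if_pos hP, dotProduct_smul, smul_eq_mul]
    ring
  · rw [if_neg hP, if_neg hP]
    exact dotProduct_zero C

omit hC in
/-- `±t ≤ |t|`. -/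
theorem sign_mul_le (e : Bool) (t : ℝ) : (if e = true then (1 : ℝ) else -1) * t ≤ |t| := by
  cases e
  · simp [neg_le_abs]
  · simp [le_abs_self]

omit hC in
/-- the sign chosen by `decide (0 ≤ t)` realises `|t|`. -/
theorem dsign_mul (t : ℝ) : (if decide (0 ≤ t) = true then (1 : ℝ) else -1) * t = |t| := by
  by_cases h : 0 ≤ t
  · simp [h, abs_of_nonneg h]
  · simp [h, abs_of_neg (lt_of_not_ge h)]

omit hC in
/-- every tower vertex has `C`-value at most `hZ`. -/
theorem dot_vtx_le (ε : (Fin n → Bool) → Bool) : C ⬝ᵥ vtx P lam ε ≤ hZ (C := C) P lam := by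
  rw [dot_vtx]
  unfold hZ
  exact Finset.sum_le_sum fun b _ => by
    by_cases hP : P b
    · rw [if_pos hP, if_pos hP]
      exact sign_mul_le _ _
    · rw [if_neg hP, if_neg hP]

omit hC in
/-- the sign vertex `vtx (sgn)` attains `hZ`. -/
theorem dot_vtx_sgn : C ⬝ᵥ vtx P lam (sgn (C := C) lam) = hZ (C := C) P lam := by
  rw [dot_vtx]
  unfold hZ
  refine Finset.sum_congr rfl fun b _ => ?_
  by_cases hP : P b
  · rw [if_pos hP, if_pos hP]
    exact dsign_mul _
  · rw [if_neg hP, if_neg hP]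

/-- every tight sign vertex IS the `sgn` vertex (uses S2c: `C·bbᵀ ≠ 0` for `b ≠ 0`). -/
theorem vtx_eq_of_tight (ε : (Fin n → Bool) → Bool) (ht : C ⬝ᵥ vtx P lam ε = hZ (C := C) P lam) :
    vtx P lam ε = vtx P lam (sgn (C := C) lam) := by
  have hterm := (Finset.sum_eq_sum_iff_of_le (s := (Finset.univ : Finset (Fin n → Bool)))
      (f := fun b => if P b then (if ε b then (1 : ℝ) else -1) * (lam b * (C ⬝ᵥ corVec ⊤ b)) else 0)
      (g := fun b => if P b then |lam b * (C ⬝ᵥ corVec (⊤ : SimpleGraph (Fin n)) b)| else 0)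
      (fun b _ => by
        by_cases hP : P b
        · simp only [if_pos hP]
          exact sign_mul_le _ _
        · simp only [if_neg hP]
          exact le_rfl)).1 (by rw [dot_vtx] at ht; exact ht)
  unfold vtx
  refine Finset.sum_congr rfl fun b _ => ?_
  by_cases hP : P b
  · rw [if_pos hP, if_pos hP]
    have hb := hterm b (Finset.mem_univ _)
    simp only [if_pos hP] at hb
    by_cases hw : lam b * (C ⬝ᵥ corVec (⊤ : SimpleGraph (Fin n)) b) = 0
    · rcases mul_eq_zero.1 hw with hl | hc
      · simp [hl]
      · have hb0 : ∀ p, b p = false := by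
          intro p
          by_contra hp
          exact switch_dot_corVec_ne_zero a hC b ⟨p, by simpa using hp⟩ hc
        rw [corVec_eq_zero_of_forall hb0, smul_zero, smul_zero]
    · have hs := dsign_mul (lam b * (C ⬝ᵥ corVec (⊤ : SimpleGraph (Fin n)) b))
      have key : (if ε b = true then (1 : ℝ) else -1) =
          (if sgn (C := C) lam b = true then (1 : ℝ) else -1) := by
        unfold sgn
        exact mul_right_cancel₀ hw (hb.trans hs.symm)
      rw [key]
  · rw [if_neg hP, if_neg hP]

omit hC in
/-- validity of `C ≤ h_Z(C)` on the tower. -/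
theorem tower_valid : ∀ y ∈ tower n P lam, C ⬝ᵥ y ≤ hZ (C := C) P lam :=
  dot_le_of_mem_convexHull _ _ _ (by rintro _ ⟨ε, rfl⟩; exact dot_vtx_le P lam ε)

/-- ★ the `C`-face of the tower is the single vertex `vtx sgn`. -/
theorem tower_face : tower n P lam ∩ {y | C ⬝ᵥ y = hZ (C := C) P lam} = {vtx P lam (sgn (C := C) lam)} := by
  show convexHull ℝ (Set.range (vtx P lam)) ∩ {y | C ⬝ᵥ y = hZ (C := C) P lam} = _
  rw [convexHull_range_inter_eq (vtx P lam) C _ (dot_vtx_le P lam)]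
  have hr : Set.range (fun j : {ε : (Fin n → Bool) → Bool // C ⬝ᵥ vtx P lam ε = hZ (C := C) P lam} =>
      vtx P lam j.1) = {vtx P lam (sgn (C := C) lam)} := by
    ext y
    simp only [Set.mem_range, Set.mem_singleton_iff]
    constructor
    · rintro ⟨⟨ε, hε⟩, rfl⟩
      exact vtx_eq_of_tight a hC P lam ε hε
    · rintro rfl
      exact ⟨⟨sgn (C := C) lam, dot_vtx_sgn P lam⟩, rfl⟩
  rw [hr, convexHull_singleton]

end Tower

end SwitchFun

/-! ## §3 The deletion read maps the switched face onto `COR(K_n)` -/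

/-- the deletion read `x ↦ (x (ι p, ι q))`, `ι = a.succAbove`. -/
def delRead (n : ℕ) (a : Fin (n + 1)) : (Fin (n + 1) × Fin (n + 1) → ℝ) →ₗ[ℝ] (Fin n × Fin n → ℝ) :=
  LinearMap.funLeft ℝ ℝ fun ij : Fin n × Fin n => (a.succAbove ij.1, a.succAbove ij.2)

/-- the deletion read of a vertex of `COR(K_{n+1})` is the vertex of `COR(K_n)` of the restricted word. -/
theorem delRead_corVec (a : Fin (n + 1)) (b : Fin (n + 1) → Bool) :
    delRead n a (corVec (⊤ : SimpleGraph (Fin (n + 1))) b) = corVec (⊤ : SimpleGraph (Fin n)) (b ∘ a.succAbove) := by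
  funext ij
  obtain ⟨i, j⟩ := ij
  rw [delRead, LinearMap.funLeft_apply, corVec_top_apply, corVec_top_apply]
  rfl

/-- the deletion read maps the switched face `F_a` of `COR(K_{n+1})` onto `COR(K_n)`. -/
theorem delRead_face (a : Fin (n + 1)) {C : Fin (n + 1) × Fin (n + 1) → ℝ} {M : ℝ}
    (tight : ∀ b : Fin (n + 1) → Bool, C ⬝ᵥ corVec (⊤ : SimpleGraph (Fin (n + 1))) b = M ↔ b a = true) :
    delRead n a '' convexHull ℝ (Set.range fun b : {b : Fin (n + 1) → Bool //
        C ⬝ᵥ corVec (⊤ : SimpleGraph (Fin (n + 1))) b = M} => corVec (⊤ : SimpleGraph (Fin (n + 1))) b.1) =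
      corPolytopeGraph (⊤ : SimpleGraph (Fin n)) := by
  unfold corPolytopeGraph
  rw [LinearMap.image_convexHull, ← Set.range_comp]
  congr 1
  ext y
  constructor
  · rintro ⟨⟨b, hb⟩, rfl⟩
    exact ⟨b ∘ a.succAbove, (delRead_corVec a b).symm⟩
  · rintro ⟨e, rfl⟩
    refine ⟨⟨@Fin.insertNth n (fun _ => Bool) a true e,
      (tight _).2 (@Fin.insertNth_apply_same n (fun _ => Bool) a true e)⟩, ?_⟩
    show delRead n a (corVec ⊤ (@Fin.insertNth n (fun _ => Bool) a true e)) = corVec ⊤ e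
    rw [delRead_corVec]
    congr 1
    funext t
    exact @Fin.insertNth_apply_succAbove n (fun _ => Bool) a true e t

end Summit.ValiantsHypothesis.ValiantsHypothesis.Theorems.FifoMatching.SwitchFace

end
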